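import Summits.PneNP.PneNP.Theorems.ConvexRankGatesLinAlgGateBlindDefs

/-!
# Route ConvexRankGates, crux `LinAlgGateBlind` (stmt-PneNP-10681): the universal silent family of a term gate

Support lemma for the research stubs `stub_sgPerm` / `stub_sgGRank` (vocabulary of
`Theorems/ConvexRankGatesLinAlgGateBlindDefs.lean`), class-independent. All the rigidity criteria of
`Theorems/ConvexRankGatesLinAlgGateBlind{RigidSpanProgram,VisibleRigidity,PermRigidity,MultiRowRigidity}.lean`
produce a small-clique DNF `⌈𝒜⌉` that is SILENT on the rejected graphs of a high-probability property `P`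
(whence `gainedNeg ≤ Pr[¬P]`) and then show that no accepted bare clique is lost. This file isolates the optimal
such family once and for all:

**`sg_silentFamily`.** For ANY Boolean function `O` of graphs and ANY property `P`, the family
`𝒜_P := {X ∈ 𝒱(l) : X is present in no rejected P-graph}` is silent on rejected `P`-graphs, so
`gainedNeg m q O 𝒜_P ≤ Pr_{G(m,q)}[¬P]`; its lost positives are EXACTLY the accepted `k`-sets `S` all of whose
small subsets are present in some rejected `P`-graph; and every family silent on the rejected `P`-graphs is
contained in `𝒜_P`, hence loses at least these positives (`lostPos_silentFamily_subset`). Consequently the SG goal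
for `O` at level `ε` FOLLOWS from: some `P` with `Pr[¬P] ≤ ε` under which at most `ε·C(m,k)` accepted bare
`k`-cliques are "fully explained by typical rejection" — a pure positive-side count once `P` is chosen; for a
PERM term gate this count is the number of bare `k`-cliques accepted by the gate RESTRICTED to the inputs that
survive in some rejected `P`-graph (the joint-closure criterion of `PermRigidity` is the case where that
restricted gate accepts nothing).

No new definitions. [folklore]
-/

-- `Summit.PneNP.PneNP.…` duplicates `PneNP` BY DESIGN (single-problem summit).
set_option linter.dupNamespace false

namespace Summit.PneNP.PneNP.Theorems

open Finset Literature.Computability.Complexity Razborov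
open Summit.PneNP.PneNP.Cruxes.LinAlgGateBlind.DnfInvariantWideGatesSeeSmallCliques

open Classical in
/-- **The universal silent family.** For any `O` and `P`: the atoms present in no rejected `P`-graph form a family
`𝒜 ⊆ 𝒱(l)` that is silent on rejected `P`-graphs (`gainedNeg ≤ Pr[¬P]`) and whose lost positives are exactly the
accepted `k`-sets all of whose small subsets occur in rejected `P`-graphs. [folklore] -/
theorem sg_silentFamily :
    ∀ (m l k : ℕ) (q : ℝ), 0 ≤ q → q ≤ 1 →
    ∀ (O : (KEdge m → Bool) → Bool) (P : (KEdge m → Bool) → Prop),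
      ∃ 𝒜 ⊆ smallSets (Fin m) l,
        (∀ G, P G → O G = false → ¬ Accepts 𝒜 G) ∧
        gainedNeg m q O 𝒜 ≤ prob q (fun G => ¬ P G) ∧
        lostPos m k O 𝒜 = (powersetCard k (univ : Finset (Fin m))).filter fun S =>
          O (cliqueVec S) = true ∧
            ∀ X ∈ smallSets (Fin m) l, X ⊆ S → ∃ G, P G ∧ O G = false ∧ CliquePresent X G := by
  intro m l k q hq0 hq1 O P
  classical
  set 𝒜 : Finset (Finset (Fin m)) := (smallSets (Fin m) l).filter fun X =>
    ∀ G, P G → O G = false → ¬ CliquePresent X G with h𝒜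
  have hsilent : ∀ G, P G → O G = false → ¬ Accepts 𝒜 G := by
    rintro G hPG hOG ⟨X, hX, hXG⟩
    exact (mem_filter.1 hX).2 G hPG hOG hXG
  refine ⟨𝒜, filter_subset _ _, hsilent, ?_, ?_⟩
  · exact prob_mono hq0 hq1 fun G hG hPG => hsilent G hPG hG.1 hG.2
  · ext S
    simp only [lostPos, mem_filter, mem_powersetCard]
    refine ⟨fun ⟨hSk, hOS, hnacc⟩ => ⟨hSk, hOS, fun X hX hXS => ?_⟩, fun ⟨hSk, hOS, hall⟩ => ⟨hSk, hOS, ?_⟩⟩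
    · by_contra hno
      push Not at hno
      refine hnacc ⟨X, mem_filter.2 ⟨hX, fun G hPG hOG hXG => ?_⟩, ?_⟩
      · exact absurd hXG (by simpa using hno G hPG hOG)
      · exact (cliquePresent_cliqueVec_self S).anti hXS
    · rintro ⟨X, hX, hXS⟩
      obtain ⟨hXl, hXrej⟩ := mem_filter.1 hX
      have hsub : X ⊆ S := (cliquePresent_cliqueVec_iff (mem_smallSets.1 hXl).2).1 hXS
      obtain ⟨G, hPG, hOG, hXG⟩ := hall X hXl hsub
      exact hXrej G hPG hOG hXG

open Classical in
/-- **Optimality of the silent family.** Any family `ℬ ⊆ 𝒱(l)` silent on the rejected `P`-graphs loses at least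
the positives lost by the universal silent family: every accepted `k`-set all of whose small subsets occur in
rejected `P`-graphs is lost by `ℬ`. [folklore] -/
theorem lostPos_silentFamily_subset :
    ∀ (m l k : ℕ) (O : (KEdge m → Bool) → Bool) (P : (KEdge m → Bool) → Prop)
      (ℬ : Finset (Finset (Fin m))), ℬ ⊆ smallSets (Fin m) l →
      (∀ G, P G → O G = false → ¬ Accepts ℬ G) →
      ((powersetCard k (univ : Finset (Fin m))).filter fun S =>
          O (cliqueVec S) = true ∧
            ∀ X ∈ smallSets (Fin m) l, X ⊆ S → ∃ G, P G ∧ O G = false ∧ CliquePresent X G)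
        ⊆ lostPos m k O ℬ := by
  intro m l k O P ℬ hℬ hsilent S hS
  classical
  simp only [mem_filter, mem_powersetCard] at hS
  obtain ⟨hSk, hOS, hall⟩ := hS
  simp only [lostPos, mem_filter, mem_powersetCard]
  refine ⟨hSk, hOS, ?_⟩
  rintro ⟨X, hX, hXS⟩
  have hXl := hℬ hX
  have hsub : X ⊆ S := (cliquePresent_cliqueVec_iff (mem_smallSets.1 hXl).2).1 hXS
  obtain ⟨G, hPG, hOG, hXG⟩ := hall X hXl hsub
  exact hsilent G hPG hOG ⟨X, hX, hXG⟩

end Summit.PneNP.PneNP.Theorems
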